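import Mathlib
import Summits.ResolutionOfSingularities.ResolutionOfSingularities.Theorems.WeightedInvariantLocalWeightedDropPolyDescentSelTail

/-!
# `WeightedInvariant.LocalWeightedDrop`, the monic polyhedron descent WITH A PREPARATION SELECTOR (ρ-T′, part 3: THE ONE-STEP LAWS, **NO INFINITE
# CHAIN FOR EVERY ADMISSIBLE SELECTOR**, the well-founded LAZY descent relation and its exits)

Crux item stmt-ResolutionOfSingularities-8899 `LocalWeightedDrop` (route `ResolutionOfSingularities/WeightedInvariant`), ENGINE skeleton v32
(ddb48572591139d5), registered stub `stub_spaceNCRankDrop`; TOT2-LINE v1.2 (`L/res-L1-w43-lead-1/g4/TOT2-LINE.md`), inner assembly, QUESTION Q6 of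
res-L1-w43-lead-1 (13:56Z, «old component = maximal-contact plane»: in the sub-regime `y ∈ O` the label has `A₀ = 0` and must NEVER be re-centred, but
`PolyDescent.succT` re-centres by the `ε`-chosen `prepPsi` after every shear) and res-type-056's CHECK (14:00Z, «does ρ-T accept the identity
re-centring on well-prepared labels?»).  [OURS · L1 W4.3 · chain w43 · stub worker res-L1-w43-stub-2 (gen 5); a SELECTOR-GENERIC PORT of the lead
prover's ρ-T files …PolyDescentShearBeta / …PolyDescentTail / …PolyDescentNoChain / …PolyDescentRegimeRank (res-L1-w43-lead-1 gen 3/4), whose proofs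
use `prepPsi` only through its well-preparing property; MODEL Cossart–Jannsen–Saito LNM 2270 Ch. 8/11–13 for `J = (y^d + Σ_{j<d} A_j y^j)`, `e = 2`.
Nothing here is a statement of any manuscript; the games are the programme's own; AI-produced, gate-checked, weaker than expert review.]

* `step_point_sel`, `step_curve_sel`, `epsL_AhatSel_lt`, `zetaL_AhatSel_succ_lt`, `zetaL_AhatSel_add_le` — verbatim ports of …PolyDescentNoChain;
* **`polyNoChainSel`** — (ρ-T′) no infinite `succTSel d ψsel`-chain of well-prepared positions with non-empty Newton set, for EVERY admissible selector
  (given ρ-M); **`polyNoChainWP`** (lazy selector, given ρ-P and ρ-M) and **`polyNoChainWP'`** (UNCONDITIONAL: `stub_polyPrep`, `stub_polyMinimality`);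
* `wellFounded_polyRelSel` / **`wellFounded_polyRelWP`**, `rank_lt_of_polyRelWP` (the lazy polyhedron rank `((wellFounded_polyRelWP hd).apply A).rank` drops at
  every lazy regime step), `wellPrepared_of_mem_succTSel`, `exit_cases_sel` / **`exit_cases_WP`** — the lazy twins of res-L1-w43-lead-1's
  `wellFounded_polyRel` / `polyRank_lt` / `wellPrepared_of_mem_succT` / `exit_cases` (p534995).
USE (Q6): the inner S-ASM strategy may follow `succTWP` UNIFORMLY — on the sub-regime `y ∈ O` (`A₀ = 0`) it never re-centres (part 1), elsewhere it
prepares only labels that need it; termination is `polyNoChainWP'`.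
-/

set_option linter.dupNamespace false -- mandated namespace of this single-conjunct summit

noncomputable section

namespace Summit.ResolutionOfSingularities.ResolutionOfSingularities.Theorems

namespace PolyDescent

open MvPowerSeries MonicDescent WildMonic Literature.RingTheory.TwoVariableSeries Literature.AlgebraicGeometry.Resolution

variable {k : Type} [Field k]

/-! ## PART 5: the one-step laws and NO INFINITE CHAIN (port of …PolyDescentNoChain) -/

section Laws

variable {d : ℕ} (hd : 0 < d) {ψsel : (Fin d → MvPowerSeries (Fin 2) k) → MvPowerSeries (Fin 2) k} (A : ℕ → (Fin d → MvPowerSeries (Fin 2) k))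
  (hsel : ∀ X : Fin d → MvPowerSeries (Fin 2) k, IsPosT d X → IsPrepRecentring d X (ψsel X))
  (hmin : ∀ (B : Fin d → MvPowerSeries (Fin 2) k) (ψ : MvPowerSeries (Fin 2) k), WellPrepared d B → IsPosT d B → constantCoeff ψ = 0 →
    ∀ w : Fin 2 → ℕ, (∀ i, 0 < w i) → ∀ P ∈ newtonSet B, ∃ Q ∈ newtonSet (shift d B ψ), Finsupp.weight w Q ≤ Finsupp.weight w P)
  (hA : ∀ m, WellPrepared d (A m) ∧ IsPosT d (A m) ∧ (newtonSet (A m)).Nonempty ∧ IsNeutralStepSel d ψsel (A m) (A (m + 1)))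
  (hex : ∀ m, ∃ n, m ≤ n ∧ IsPointStepT A n)

include hd hsel hmin hA in
/-- POINT-STEP LAW for the selector chain (verbatim `step_point`). -/
theorem step_point_sel {m : ℕ} (hm : IsPointStepT A m) :
    epsL (newtonSet (AhatSel ψsel A hex (m + 1))) = epsL (newtonSet (AhatSel ψsel A hex m)) ∧
    zetaL (newtonSet (AhatSel ψsel A hex (m + 1))) =
      zetaL (newtonSet (AhatSel ψsel A hex m)) + epsL (newtonSet (AhatSel ψsel A hex m)) - d.factorial := by
  obtain ⟨ψ, hψ0, hQpos, hAeq⟩ := pointStepSel_shape A hsel hA hm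
  have hh'noY := hser_noY (IsPointStepT A) (paramSel ψsel A) hex (m + 1)
  have hrel := hser_of_step (IsPointStepT A) (paramSel ψsel A) hex hm
  obtain ⟨hψ₀0, -, -, -⟩ := prep_SlabSel A hsel hA hex m
  obtain ⟨hÂWP, hÂpos, hÂne, -, -⟩ := AhatSel_spec A hsel hmin hA hex m
  obtain ⟨hÂ'WP, hÂ'pos, hÂ'ne, -, -⟩ := AhatSel_spec A hsel hmin hA hex (m + 1)
  have hSpos : IsPosT d (SlabSel ψsel A hex m) := isPosT_SlabSel A hA hex m
  set ψ₀ := ψsel (SlabSel ψsel A hex m) with hψ₀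
  set ψ' := shear (X 0 * hser (IsPointStepT A) (paramSel ψsel A) hex (m + 1)) ψ with hψ'
  have hψ'0 : constantCoeff ψ' = 0 := constantCoeff_shear_eq_zero _ hψ0
  have hQ'eq : shearT (X 0 * hser (IsPointStepT A) (paramSel ψsel A) hex (m + 1)) (shift d (shearT (C (paramSel ψsel A m)) (A m)) ψ) =
      shift d (AhatSel ψsel A hex m) (ψ' - ψ₀) := by
    rw [shearT_shift, shearT_X_mul_shearT_C, ← hrel, AhatSel_eq, shift_shift, sub_add_cancel]
    rfl
  have hQ'pos : IsPosT d (shift d (AhatSel ψsel A hex m) (ψ' - ψ₀)) := by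
    rw [← hQ'eq]; exact isPosT_shearT _ hQpos
  have hS'eq : SlabSel ψsel A hex (m + 1) = blowOneT d (shift d (AhatSel ψsel A hex m) (ψ' - ψ₀)) := by
    rw [← hQ'eq, blowOneT_shearT_X_mul _ _ hh'noY (sub_le_sum_of_isPosT hQpos), ← hAeq]
    rfl
  have hdiff0 : constantCoeff (ψ' - ψ₀) = 0 := by rw [map_sub, hψ'0, hψ₀, hψ₀0, sub_zero]
  have hXpos : IsPosT d (blowOneT d (AhatSel ψsel A hex m)) :=
    isPosT_blowOneT_of_shift hmin hÂWP hÂpos hdiff0 hQ'pos (by rw [← hS'eq]; exact isPosT_SlabSel A hA hex (m + 1))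
  have hXWP : WellPrepared d (blowOneT d (AhatSel ψsel A hex m)) := wellPrepared_blowOneT _ hÂpos hÂWP
  have hNX : newtonSet (blowOneT d (AhatSel ψsel A hex m)) = psi d.factorial '' newtonSet (AhatSel ψsel A hex m) :=
    newtonSet_blowOneT _ hÂpos
  have hXne : (newtonSet (blowOneT d (AhatSel ψsel A hex m))).Nonempty := by rw [hNX]; exact hÂne.image _
  set χ := ψsel (SlabSel ψsel A hex (m + 1)) + blowOne 1 (ψ' - ψ₀) with hχ
  have hYeq : AhatSel ψsel A hex (m + 1) = shift d (blowOneT d (AhatSel ψsel A hex m)) χ := by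
    rw [hχ, ← shift_shift, ← blowOneT_shift _ _ (fun j => (hÂpos j).le) (one_le_order_iff_constCoeff_eq_zero.mpr hdiff0), ← hS'eq]
    rfl
  have hχ0 : constantCoeff χ = 0 := constantCoeff_eq_zero_of_isPosT_shift hd hXpos (by rw [← hYeq]; exact hÂ'pos)
  obtain ⟨-, -, hε, hζ⟩ := invariants_eq_of_wellPrepared hmin hXWP hXpos hχ0 hXne (by rw [← hYeq]; exact hÂ'WP)
    (by rw [← hYeq]; exact hÂ'pos) (by rw [← hYeq]; exact hÂ'ne)
  rw [hYeq, hε, hζ, hNX, epsL_image_psiC, zetaL_image_psiC (factorial_le_sum_of_isPosT hÂpos) hÂne]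
  exact ⟨rfl, rfl⟩

include hd hsel hmin hA in
/-- CURVE-STEP LAW for the selector chain (verbatim `step_curve`). -/
theorem step_curve_sel {m : ℕ} (hm : ¬ IsPointStepT A m) :
    epsL (newtonSet (AhatSel ψsel A hex (m + 1))) = epsL (newtonSet (AhatSel ψsel A hex m)) ∧
    zetaL (newtonSet (AhatSel ψsel A hex (m + 1))) + d.factorial = zetaL (newtonSet (AhatSel ψsel A hex m)) := by
  have hP1 : IsPermissibleOneT d (A m) := by unfold IsPointStepT at hm; push Not at hm; exact hm
  have hrel := hser_of_not_step (IsPointStepT A) (paramSel ψsel A) hex hm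
  obtain ⟨hÂWP, hÂpos, hÂne, -, -⟩ := AhatSel_spec A hsel hmin hA hex m
  obtain ⟨hÂ'WP, hÂ'pos, hÂ'ne, -, -⟩ := AhatSel_spec A hsel hmin hA hex (m + 1)
  have hSP1 : IsPermissibleOneT d (SlabSel ψsel A hex m) := isPermissibleOneT_shearT _ hP1
  have hÂP1 : IsPermissibleOneT d (AhatSel ψsel A hex m) := isPermissibleOneT_AhatSel_of_not_isPointStepT A hsel hmin hA hex hm
  set ψ₀ := ψsel (SlabSel ψsel A hex m) with hψ₀
  set ψ₁ := ψsel (SlabSel ψsel A hex (m + 1)) with hψ₁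
  have hS'eq : SlabSel ψsel A hex (m + 1) = divOneT d (SlabSel ψsel A hex m) := by
    show shearT (hser (IsPointStepT A) (paramSel ψsel A) hex (m + 1)) (A (m + 1)) = _
    rw [hrel, succ_eq_divOneT_sel A hA hm, ← divOneT_shearT _ hP1]
    rfl
  obtain ⟨H, hH⟩ : X 0 ∣ ψ₀ := X_dvd_of_isPermissibleOneT_shift hd hSP1 (by rw [hψ₀, ← AhatSel_eq]; exact hÂP1)
  have hZeq : divOneT d (AhatSel ψsel A hex m) = shift d (divOneT d (SlabSel ψsel A hex m)) H := by
    rw [AhatSel_eq, ← hψ₀, hH, divOneT_shift _ _ hSP1]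
  have hYeq : AhatSel ψsel A hex (m + 1) = shift d (divOneT d (AhatSel ψsel A hex m)) (ψ₁ - H) := by
    rw [hZeq, shift_shift, sub_add_cancel, AhatSel_eq, ← hψ₁, hS'eq]
  have hcomp : divOneT d (shift d (AhatSel ψsel A hex m) (X 0 * (ψ₁ - H))) = AhatSel ψsel A hex (m + 1) := by
    rw [divOneT_shift _ _ hÂP1, ← hYeq]
  have hg0 : constantCoeff (X 0 * (ψ₁ - H) : MvPowerSeries (Fin 2) k) = 0 := by
    rw [map_mul, constantCoeff_X, zero_mul]
  have hpos₃ : IsPosT d (divOneT d (shift d (AhatSel ψsel A hex m) (X 0 * (ψ₁ - H)))) := by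
    rw [hcomp]; exact hÂ'pos
  have hZpos : IsPosT d (divOneT d (AhatSel ψsel A hex m)) :=
    isPosT_divOneT_of_shift hmin hÂWP hÂpos hÂP1 hg0 (isPermissibleOneT_shift_X_mul hÂP1 _) hpos₃
  have hχ0 : constantCoeff (ψ₁ - H) = 0 :=
    constantCoeff_eq_zero_of_isPosT_shift hd hZpos (by rw [← hYeq]; exact hÂ'pos)
  have hZWP : WellPrepared d (divOneT d (AhatSel ψsel A hex m)) := wellPrepared_divOneT _ hÂP1 hÂWP
  have hNZ := newtonSet_divOneT (AhatSel ψsel A hex m) hÂP1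
  have hZne : (newtonSet (divOneT d (AhatSel ψsel A hex m))).Nonempty := by rw [hNZ]; exact hÂne.image _
  obtain ⟨-, -, hε, hζ⟩ := invariants_eq_of_wellPrepared hmin hZWP hZpos hχ0 hZne (by rw [← hYeq]; exact hÂ'WP)
    (by rw [← hYeq]; exact hÂ'pos) (by rw [← hYeq]; exact hÂ'ne)
  rw [hYeq, hε, hζ, hNZ, epsL_image_shift (shiftOneF_snd d _) hÂne, zetaL_image_shift_add (shiftOneF_fst hÂP1) (shiftOneF_snd d _) hÂne]
  exact ⟨rfl, rfl⟩

include hd hsel hmin hA in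
/-- `ε(Â m) < d!` for every `m`. -/
theorem epsL_AhatSel_lt (m : ℕ) : epsL (newtonSet (AhatSel ψsel A hex m)) < d.factorial := by
  obtain ⟨n, hmn, hn⟩ := hex m
  obtain ⟨j, rfl⟩ : ∃ j, n = m + j := ⟨n - m, by omega⟩
  induction j generalizing m with
  | zero => exact epsL_AhatSel_lt_of_isPointStepT A hsel hA hex (by simpa using hn)
  | succ j ih =>
    by_cases hm : IsPointStepT A m
    · exact epsL_AhatSel_lt_of_isPointStepT A hsel hA hex hm
    · rw [← (step_curve_sel hd A hsel hmin hA hex hm).1]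
      exact ih (m + 1) (by omega) (by rw [show m + 1 + j = m + (j + 1) by omega]; exact hn)

include hd hsel hmin hA in
/-- `ζ` DROPS AT EVERY STEP of the re-centred straightened selector chain. -/
theorem zetaL_AhatSel_succ_lt (m : ℕ) : zetaL (newtonSet (AhatSel ψsel A hex (m + 1))) < zetaL (newtonSet (AhatSel ψsel A hex m)) := by
  obtain ⟨-, hpos, hne, -, -⟩ := AhatSel_spec A hsel hmin hA hex m
  by_cases hm : IsPointStepT A m
  · obtain ⟨-, hζ⟩ := step_point_sel hd A hsel hmin hA hex hm
    have hε := epsL_AhatSel_lt hd A hsel hmin hA hex m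
    obtain ⟨P, hP, hP1, hP0⟩ := exists_eq_zetaL hne
    have h := factorial_lt_sum_of_isPosT hpos P hP
    rw [hP0, hP1] at h
    omega
  · have h := (step_curve_sel hd A hsel hmin hA hex hm).2
    have := Nat.factorial_pos d
    omega

include hd hsel hmin hA in
/-- Hence `ζ(Â m) + m ≤ ζ(Â 0)`. -/
theorem zetaL_AhatSel_add_le (m : ℕ) : zetaL (newtonSet (AhatSel ψsel A hex m)) + m ≤ zetaL (newtonSet (AhatSel ψsel A hex 0)) := by
  induction m with
  | zero => simp
  | succ m ih => have := zetaL_AhatSel_succ_lt hd A hsel hmin hA hex m; omega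

end Laws

/-- **(ρ-T WITH A PREPARATION SELECTOR) NO INFINITE CHAIN of well-prepared positions with non-empty Newton set along the selector strategy
`succTSel d ψsel`, for ANY admissible selector** (`ψsel X` well-preparing for every position `X`) and Hironaka's minimality (ρ-M) — verbatim the
proof of `stub_polyNoChain` (which is the instance `ψsel = prepPsi d`). -/
theorem polyNoChainSel (k : Type) [Field k] {d : ℕ} (hd : 0 < d) {ψsel : (Fin d → MvPowerSeries (Fin 2) k) → MvPowerSeries (Fin 2) k}
    (hsel : ∀ X : Fin d → MvPowerSeries (Fin 2) k, IsPosT d X → IsPrepRecentring d X (ψsel X))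
    (hmin : ∀ (B : Fin d → MvPowerSeries (Fin 2) k) (ψ : MvPowerSeries (Fin 2) k), WellPrepared d B → IsPosT d B → constantCoeff ψ = 0 →
      ∀ w : Fin 2 → ℕ, (∀ i, 0 < w i) → ∀ P ∈ newtonSet B, ∃ Q ∈ newtonSet (shift d B ψ), Finsupp.weight w Q ≤ Finsupp.weight w P) :
    ¬ ∃ A : ℕ → (Fin d → MvPowerSeries (Fin 2) k), ∀ m, WellPrepared d (A m) ∧ IsPosT d (A m) ∧ (newtonSet (A m)).Nonempty ∧
      A (m + 1) ∈ succTSel d ψsel (A m) := by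
  rintro ⟨A, hA⟩
  obtain ⟨M, hM⟩ := exists_neutral_tailSel hsel hmin A hA
  set B : ℕ → (Fin d → MvPowerSeries (Fin 2) k) := fun m => A (M + m) with hB
  have hBA : ∀ m, WellPrepared d (B m) ∧ IsPosT d (B m) ∧ (newtonSet (B m)).Nonempty ∧ IsNeutralStepSel d ψsel (B m) (B (m + 1)) := by
    intro m
    obtain ⟨hwp, hpos, hne, -⟩ := hA (M + m)
    refine ⟨hwp, hpos, hne, ?_⟩
    have h := (hM (M + m) (by omega)).2
    rw [show M + m + 1 = M + (m + 1) by omega] at h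
    exact h
  have hex : ∀ m, ∃ n, m ≤ n ∧ IsPointStepT B n := exists_isPointStepT_ge_sel B hBA
  have h := zetaL_AhatSel_add_le hd B hsel hmin hBA hex (zetaL (newtonSet (AhatSel ψsel B hex 0)) + 1)
  omega

/-- **(ρ-T FOR THE LAZY STRATEGY)** given (ρ-P) and (ρ-M) as hypotheses: no infinite `succTWP`-chain of well-prepared positions with non-empty Newton
set. -/
theorem polyNoChainWP (k : Type) [Field k] {d : ℕ} (hd : 0 < d)
    (hprep : ∀ A : Fin d → MvPowerSeries (Fin 2) k, IsPosT d A → ∃ ψ : MvPowerSeries (Fin 2) k, IsPrepRecentring d A ψ)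
    (hmin : ∀ (B : Fin d → MvPowerSeries (Fin 2) k) (ψ : MvPowerSeries (Fin 2) k), WellPrepared d B → IsPosT d B → constantCoeff ψ = 0 →
      ∀ w : Fin 2 → ℕ, (∀ i, 0 < w i) → ∀ P ∈ newtonSet B, ∃ Q ∈ newtonSet (shift d B ψ), Finsupp.weight w Q ≤ Finsupp.weight w P) :
    ¬ ∃ A : ℕ → (Fin d → MvPowerSeries (Fin 2) k), ∀ m, WellPrepared d (A m) ∧ IsPosT d (A m) ∧ (newtonSet (A m)).Nonempty ∧
      A (m + 1) ∈ succTWP d (A m) :=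
  polyNoChainSel k hd (fun _ hX => isPrepRecentring_prepSelWP hprep hX) hmin

/-- **UNCONDITIONAL FORM** (ρ-P `stub_polyPrep` and ρ-M `stub_polyMinimality` discharge the hypotheses): no infinite lazy chain, every field, `d ≥ 1`. -/
theorem polyNoChainWP' (k : Type) [Field k] {d : ℕ} (hd : 0 < d) :
    ¬ ∃ A : ℕ → (Fin d → MvPowerSeries (Fin 2) k), ∀ m, WellPrepared d (A m) ∧ IsPosT d (A m) ∧ (newtonSet (A m)).Nonempty ∧
      A (m + 1) ∈ succTWP d (A m) :=
  polyNoChainWP k hd (stub_polyPrep k d hd) (stub_polyMinimality k d hd)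

/-! ## PART 6: the regime rank of the selector strategy (port of …PolyDescentRegimeRank) -/

/-- The descent relation of an admissible selector strategy is well-founded. -/
theorem wellFounded_polyRelSel {d : ℕ} (hd : 0 < d) {ψsel : (Fin d → MvPowerSeries (Fin 2) k) → MvPowerSeries (Fin 2) k}
    (hsel : ∀ X : Fin d → MvPowerSeries (Fin 2) k, IsPosT d X → IsPrepRecentring d X (ψsel X)) : WellFounded (PolyRelSel (k := k) d ψsel) :=
  wellFounded_iff_isEmpty_descending_chain.mpr ⟨fun ⟨f, hf⟩ =>
    polyNoChainSel k hd hsel (stub_polyMinimality k d hd)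
      ⟨f, fun m => ⟨(hf m).2.1.1, (hf m).2.1.2.1, (hf m).2.1.2.2, (hf m).1⟩⟩⟩

/-- The lazy descent relation is well-founded (every field, `d ≥ 1`). -/
theorem wellFounded_polyRelWP {d : ℕ} (hd : 0 < d) : WellFounded (PolyRelSel (k := k) d (prepSelWP d)) :=
  wellFounded_polyRelSel hd fun _ hX => isPrepRecentring_prepSelWP (stub_polyPrep k d hd) hX

/-- A LAZY REGIME STEP LOWERS THE LAZY POLYHEDRON RANK `A ↦ ((wellFounded_polyRelWP hd).apply A).rank : label → Ordinal` (Mathlib's `Acc.rank`,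
the shape of res-L1-w43-lead-1's `polyRank`; no new definition needed). -/
theorem rank_lt_of_polyRelWP {d : ℕ} (hd : 0 < d) {A A' : Fin d → MvPowerSeries (Fin 2) k} (h : PolyRelSel d (prepSelWP d) A' A) :
    ((wellFounded_polyRelWP (k := k) hd).apply A').rank < ((wellFounded_polyRelWP (k := k) hd).apply A).rank :=
  ((wellFounded_polyRelWP (k := k) hd).apply A).rank_lt_of_rel h

/-- The same for any admissible selector. -/
theorem rank_lt_of_polyRelSel {d : ℕ} (hd : 0 < d) {ψsel : (Fin d → MvPowerSeries (Fin 2) k) → MvPowerSeries (Fin 2) k}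
    (hsel : ∀ X : Fin d → MvPowerSeries (Fin 2) k, IsPosT d X → IsPrepRecentring d X (ψsel X)) {A A' : Fin d → MvPowerSeries (Fin 2) k}
    (h : PolyRelSel d ψsel A' A) :
    ((wellFounded_polyRelSel (k := k) hd hsel).apply A').rank < ((wellFounded_polyRelSel (k := k) hd hsel).apply A).rank :=
  ((wellFounded_polyRelSel (k := k) hd hsel).apply A).rank_lt_of_rel h

/-- **SUCCESSORS OF REGIME LABELS STAY WELL-PREPARED** along any admissible selector strategy. -/
theorem wellPrepared_of_mem_succTSel {d : ℕ} (hd : 0 < d) {ψsel : (Fin d → MvPowerSeries (Fin 2) k) → MvPowerSeries (Fin 2) k}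
    (hsel : ∀ X : Fin d → MvPowerSeries (Fin 2) k, IsPosT d X → IsPrepRecentring d X (ψsel X))
    {A A' : Fin d → MvPowerSeries (Fin 2) k} (hWP : WellPrepared d A) (hpos : IsPosT d A) (hA' : A' ∈ succTSel d ψsel A) :
    WellPrepared d A' := by
  classical
  by_cases h1 : IsPermissibleOneT d A
  · rw [succTSel_of_isPermissibleOneT _ h1, Set.mem_singleton_iff] at hA'
    rw [hA']; exact wellPrepared_divOneT A h1 hWP
  by_cases h2 : IsPermissibleTwoT d A
  · rw [succTSel_of_isPermissibleTwoT _ h1 h2, Set.mem_singleton_iff] at hA'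
    rw [hA']; exact wellPrepared_divTwoT A h2 hWP
  by_cases h3 : HasGraphCurveT d A
  · rw [succTSel_of_hasGraphCurveT _ h1 h2 h3, Set.mem_singleton_iff] at hA'
    obtain ⟨ψ, -, -, hperm⟩ := graphShearT_spec h3
    have hposY : IsPosT d (shearT (graphShearT d A) A) := isPosT_shearT _ hpos
    obtain ⟨-, -, hWPB, -⟩ := hsel _ hposY
    have hpermB : IsPermissibleTwoT d (shift d (shearT (graphShearT d A) A) (ψsel (shearT (graphShearT d A) A))) := by
      refine isPermissibleTwoT_of_wellPrepared_of_isPermissibleTwoT_shift hd hWPB (φ := ψ - ψsel (shearT (graphShearT d A) A)) ?_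
      rw [shift_shift, sub_add_cancel]
      exact hperm
    rw [hA']; exact wellPrepared_divTwoT _ hpermB hWPB
  · rw [succTSel_of_point _ h1 h2 h3] at hA'
    rcases hA' with hA' | ⟨c, -, rfl⟩
    · rcases hA' with rfl | rfl
      · exact wellPrepared_blowOneT A hpos hWP
      · exact wellPrepared_blowTwoT A hpos hWP
    · have hposY : IsPosT d (shearT (C c) A) := isPosT_shearT _ hpos
      obtain ⟨-, hposB, hWPB, -⟩ := hsel _ hposY
      exact wellPrepared_blowOneT _ hposB hWPB

/-- THE REGIME EXITS of an admissible selector strategy, read (verbatim `exit_cases`). -/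
theorem exit_cases_sel {d : ℕ} (hd : 0 < d) {ψsel : (Fin d → MvPowerSeries (Fin 2) k) → MvPowerSeries (Fin 2) k}
    (hsel : ∀ X : Fin d → MvPowerSeries (Fin 2) k, IsPosT d X → IsPrepRecentring d X (ψsel X))
    {A A' : Fin d → MvPowerSeries (Fin 2) k} (hA : InPoly d A) (hA' : A' ∈ succTSel d ψsel A)
    (hn : ¬ InPoly d A') : ¬ (newtonSet A').Nonempty ∨ ¬ IsPosT d A' := by
  have hWP' := wellPrepared_of_mem_succTSel hd hsel hA.1 hA.2.1 hA'
  by_contra h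
  push Not at h
  exact hn ⟨hWP', h.2, h.1⟩

/-- The lazy instances. -/
theorem exit_cases_WP {d : ℕ} (hd : 0 < d) {A A' : Fin d → MvPowerSeries (Fin 2) k} (hA : InPoly d A) (hA' : A' ∈ succTWP d A)
    (hn : ¬ InPoly d A') : ¬ (newtonSet A').Nonempty ∨ ¬ IsPosT d A' :=
  exit_cases_sel hd (fun _ hX => isPrepRecentring_prepSelWP (stub_polyPrep k d hd) hX) hA hA' hn


end PolyDescent

end Summit.ResolutionOfSingularities.ResolutionOfSingularities.Theorems

end
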